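import Mathlib
import Literature.Analysis.Convex.LinearProgrammingDuality
import Literature.Combinatorics.Optimization.PseudoDensityFourier
import Literature.Barriers.PneNP.LowDegreeCounterexamples
import HarnessLib

/-!
# Bazzi's theorem: fooling by bounded independence / small bias ⟺ sandwiching polynomials
# (Bazzi 2009, Theorem 4.2 and Theorem A.1), by LP duality

Source (read first-hand 2026-08-28; held text = the author's 62-page full version, corpus key
`paper:doi-10-1109-focs-2007-28`, whose §/Theorem numbering is that of the journal version):
L. M. J. Bazzi, *Polylogarithmic independence can fool DNF formulas*, SIAM J. Comput. **38** (2009),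
no. 6, 2220–2272 (FOCS 2007) [Bazzi2009].  Page numbers below are those of the held full version.

Printed statements (verbatim up to notation; `E` is expectation over the uniform distribution,
`E_μ` over `μ`, `X_y(x) = (−1)^{⟨x,y⟩}` the characters of `{0,1}ⁿ`, `deg` the multilinear degree):

* §1 (p. 3): "If `μ` is a probability distribution on `{0,1}ⁿ` and `g : {0,1}ⁿ → {0,1}` is a boolean
  function, we say that `μ` `ε`-fools `g` if `|Pr_{x∼μ}[g(x) = 1] − Pr_{x∈{0,1}ⁿ}[g(x) = 1]| ≤ ε`."
  Definition 4.1 (p. 10): "We say that a distribution property `ε`-fools a function `g` if any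
  probability distribution on `{0,1}ⁿ` with this property `ε`-fools `g`."
* Appendix A (p. 60): "By definition `μ` has the `(δ,k)`-bias property if `μ` `δ`-fools all parity
  functions on `k` or fewer of the `n` binary variables. In terms of the characters `{X_y}_y`, this is
  equivalent to saying that `|E_μ X_y| ≤ 2δ` for each nonzero `y` in `{0,1}ⁿ` whose weight is less
  than or equal to `k`."  (p. 10: "the `k`-wise independence property is the `(0,k)`-bias property".)
* **Theorem A.1** (p. 60): "Let `g : {0,1}ⁿ → {0,1}`, `k ≥ 0` an integer, and `δ, ε ≥ 0`. Then the
  `(δ,k)`-bias property `ε`-fools `g` if and only if there exist `g_l, g_u : {0,1}ⁿ → ℝ` such that: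
  i) `deg(g_l) ≤ k` and `deg(g_u) ≤ k`; ii) `g_l ≤ g ≤ g_u`;
  iii) `2δ Σ_{y≠0} |ĝ_l(y)| + E(g − g_l) ≤ ε` and `2δ Σ_{y≠0} |ĝ_u(y)| + E(g_u − g) ≤ ε`."
* **Theorem 4.2** (p. 10, the case `δ = 0`): "Let `g : {0,1}ⁿ → {0,1}`, `k ≥ 0` an integer, and
  `ε ≥ 0`. Then the `k`-wise independence property `ε`-fools `g` if and only if there exist
  `g_l, g_u : {0,1}ⁿ → ℝ` such that: i) (low degree) `deg(g_l) ≤ k` and `deg(g_u) ≤ k`;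
  ii) (sandwiching polynomials) `g_l ≤ g ≤ g_u`; iii) (small `L₁`-approximation error)
  `E(g − g_l) ≤ ε` and `E(g_u − g) ≤ ε`."
* §4 (pp. 10–11): "Let `μ` be a probability distribution on `{0,1}ⁿ` and let `k ≥ 0` be an integer.
  Then the following are equivalent: a) `μ` is `k`-wise independent; b) `E_μ X_y = 0` for each
  nonzero `y` in `{0,1}ⁿ` whose weight is less than or equal to `k`; c) `E_μ p = E p` for each
  `p : {0,1}ⁿ → ℝ` such that `deg(p) ≤ k`."
* Proof of Theorem A.1 (p. 61): "The proof is by linear-programming duality. Let `M_k ⊂ ℝ^{{0,1}ⁿ}`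
  be the convex polytope of `(δ,k)`-biased probability distributions … `M_k` consists of all
  `μ : {0,1}ⁿ → ℝ` such that `μ ≥ 0`, `Σ_x μ(x) = 1`, and `−2δ ≤ Σ_x μ(x)X_y(x) ≤ 2δ` for each
  `y ∈ N_k*` … `P_u = max_{μ∈M_k} E_μ g − E g` … It is enough to show that the dual linear programs
  are: I) `P_u = min_{g_u} E(g_u − g) + 2δ Σ_{y≠0} |ĝ_u(y)|` [over `deg g_u ≤ k`, `g_u ≥ g`] …
  (II) follows from (I) by replacing `g` with `1 − g`."

Rendering.  The cube is `Fin n → Bool` with the tree's Walsh characters `walsh S`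
(`Probability/RandomGraphs/LowDegree.lean`; Bazzi's `X_y` with `y` the indicator of `S`), Fourier
coefficients `cubeFourierCoeff` (`Computability/Complexity/BooleanFourier.lean`), uniform expectation
`cubeExpect g = (Σ_x g x)/2ⁿ` and "`deg ≤ k`" `= HasDegreeLE k` (`Combinatorics/Optimization/
PatternMatrixPsdRank.lean`; `⟺ ĝ(S) = 0` for `|S| > k`, `hasDegreeLE_iff_cubeFourierCoeff_eq_zero`).
Exactly as in the printed proof (p. 61), a probability distribution on the cube is a point of the
standard simplex `stdSimplex ℝ (Fin n → Bool)` (Mathlib), `μ` `ε`-fools `g` is `Fools ε μ g`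
(`|Σ_x μ x · g x − E g| ≤ ε`), and the `(δ,k)`-bias property is `IsDeltaKBiased δ k μ`
(in the printed character form `|E_μ χ_S| ≤ 2δ`, `0 < |S| ≤ k`).  `Σ_{y≠0} |ĝ(y)|` is
`fourierTailL1 g`.  Everything is typed and PROVED for every REAL-valued `g` (print: Boolean `g`;
the LP argument never uses Booleanity beyond `Pr_μ[g = 1] = E_μ g`, p. 61), with `δ ≥ 0` and all real
`ε` (for `ε < 0` both sides are false):

* `Bazzi2009_thmA1` — Theorem A.1; `Bazzi2009_thm42` — Theorem 4.2 (`δ = 0`);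
* `Bazzi2009_thm42_pmf` — Theorem 4.2 over the tree's measure-theoretic vocabulary
  `μ : PMF (Fin n → Bool)`, `Literature.Barriers.PneNP.IsDWiseIndependent k μ` (every marginal on `≤ k`
  coordinates uniform — Bazzi's definition (a), p. 3/p. 10), through the equivalence (a) ⟺ (b) of
  p. 10, `isDWiseIndependent_iff_charMean_eq_zero` (the direction (a) ⟹ (b) was already
  `IsDWiseIndependent.charMean_eq_zero`; (b) ⟹ (a) is Fourier inversion on the sub-cube `{0,1}^S`),
  and (b) ⟹ (c), `sum_mul_eq_cubeExpect_of_hasDegreeLE`;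
* the "if" halves in the printed direct form of p. 11 (`fools_of_sandwich`: weak duality), and the
  strong-duality half `exists_upper_sandwich`, obtained — as printed — from the Duality theorem of
  linear programming, here the tree's `Literature.Analysis.Convex.LPDuality.duality_nonneg_le`
  (Schrijver 1986, §7.4 (19): `max{cx | x ≥ 0, Ax ≤ b} = min{yb | y ≥ 0, yA ≥ c}`) applied to the
  LP of p. 61 (rows `±Σ_x μ(x) ≤ ±1`, `±Σ_x μ(x)χ_S(x) ≤ 2δ` for `0 < |S| ≤ k`; the dual vector
  `(α', α'')` is read as the polynomial `g_u = Σ_{|S|≤k} (α'_S − α''_S) χ_S` with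
  `|α'_S − α''_S| ≤ α'_S + α''_S`, p. 61 "`min{a' + a'' : a', a'' ≥ 0, a' − a'' = a} = |a|`").
  Deviation: the lower polynomial is obtained from the upper one for `−g` (print: for `1 − g`; the same
  change of variables, valid for real `g`).

Typed for the pnp-psdrank cell (memo LIT-39 (N3): sandwiching = `L¹` one-sided approximation from
both sides = fooling by bounded independence) and for `BravermanPolylogFooling.lean` (whose fact is
stated over `IsDWiseIndependent`; its docstring records that the sandwiching half was not in the
tree).  No named facts, no new notation, no instances.
-/

noncomputable section

open Finset Matrix
open Literature.Probability.RandomGraphs.LowDegree (sgn sgn_true sgn_false sgn_mul_self walsh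
  walsh_empty charMean charMean_empty sum_toReal_eq_one)
open Literature.Computability.Complexity.LowDegree (cubeFourierCoeff sum_cubeFourierCoeff_mul_walsh
  sum_walsh_mul_walsh_index)
open Literature.Combinatorics.Optimization (HasDegreeLE cubeExpect
  hasDegreeLE_iff_cubeFourierCoeff_eq_zero cubeFourierCoeff_sum_walsh)
open Literature.Barriers.PneNP (IsDWiseIndependent sum_toReal_mul_comp)

namespace Literature.Computability.Complexity.Sandwiching

variable {n : ℕ}

/-! ### Definitions -/

/-- **`μ` `ε`-fools `g`** (for a weight vector `μ` on the cube and a real test `g`):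
`|E_μ g − E g| ≤ ε`, `E_μ g = Σ_x μ(x) g(x)`, `E` uniform ("`|Pr_{x∼μ}[g(x)=1] − Pr_x[g(x)=1]| ≤ ε`"
for Boolean `g`, since then `Pr_μ[g = 1] = E_μ g`). [cite: Bazzi2009, §1 (p. 3) and App. A (p. 61)] -/
def Fools (ε : ℝ) (μ g : (Fin n → Bool) → ℝ) : Prop :=
  |∑ x, μ x * g x - cubeExpect g| ≤ ε

/-- **`μ` is a `(δ,k)`-biased probability distribution**: a point of the polytope `M_k` of p. 61 —
`μ ≥ 0`, `Σ_x μ(x) = 1` (i.e. `μ ∈ stdSimplex`), and `|E_μ χ_S| = |Σ_x μ(x)χ_S(x)| ≤ 2δ` for every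
`S` with `0 < |S| ≤ k` ("`μ` `δ`-fools all parity functions on `k` or fewer variables"; `δ = 0` is
`k`-wise independence in its character form (b), p. 10). [cite: Bazzi2009, App. A (pp. 60–61)] -/
def IsDeltaKBiased (δ : ℝ) (k : ℕ) (μ : (Fin n → Bool) → ℝ) : Prop :=
  μ ∈ stdSimplex ℝ (Fin n → Bool) ∧
    ∀ S : Finset (Fin n), S.Nonempty → S.card ≤ k → |∑ x, μ x * walsh S x| ≤ 2 * δ

/-- **`Σ_{y ≠ 0} |ĝ(y)|`**, the `ℓ¹` mass of the non-constant Fourier coefficients ("small `L₁`-norm in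
the Fourier domain"). [cite: Bazzi2009, Thm A.1 iii) (p. 60)] -/
def fourierTailL1 (g : (Fin n → Bool) → ℝ) : ℝ :=
  ∑ S ∈ (univ : Finset (Finset (Fin n))).erase ∅, |cubeFourierCoeff g S|

/-! ### Fourier bookkeeping -/

/-- `E g = ĝ(∅)`. [cite: Bazzi2009, §3 (p. 9, Fourier preliminaries)] -/
theorem cubeExpect_eq_cubeFourierCoeff_empty (g : (Fin n → Bool) → ℝ) :
    cubeExpect g = cubeFourierCoeff g ∅ := by
  rw [Literature.Computability.Complexity.LowDegree.cubeFourierCoeff_empty]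
  rfl

/-- `E` is linear: `E(g − h) = E g − E h`. [cite: Bazzi2009, §3 (p. 9)] -/
theorem cubeExpect_sub (g h : (Fin n → Bool) → ℝ) :
    cubeExpect (fun x => g x - h x) = cubeExpect g - cubeExpect h := by
  unfold cubeExpect
  rw [sum_sub_distrib, sub_div]

/-- `(−g)^ = −ĝ` (also `Literature.Computability.Complexity.cubeFourierCoeff_neg` of
`ACFourierTails.lean`, re-derived to keep the import closure small). [cite: Bazzi2009, §3 (p. 9)] -/
private theorem cubeFourierCoeff_neg (g : (Fin n → Bool) → ℝ) (S : Finset (Fin n)) :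
    cubeFourierCoeff (fun x => -g x) S = -cubeFourierCoeff g S := by
  unfold Literature.Computability.Complexity.LowDegree.cubeFourierCoeff
  rw [← neg_div, ← sum_neg_distrib]
  congr 1
  exact sum_congr rfl fun x _ => by ring

/-- `fourierTailL1 (−g) = fourierTailL1 g`. [cite: Bazzi2009, Thm A.1 (p. 60)] -/
theorem fourierTailL1_neg (g : (Fin n → Bool) → ℝ) :
    fourierTailL1 (fun x => -g x) = fourierTailL1 g := by
  unfold fourierTailL1
  exact sum_congr rfl fun S _ => by rw [cubeFourierCoeff_neg, abs_neg]

/-- `0 ≤ fourierTailL1 g`. [cite: Bazzi2009, Thm A.1 (p. 60)] -/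
theorem fourierTailL1_nonneg (g : (Fin n → Bool) → ℝ) : 0 ≤ fourierTailL1 g :=
  sum_nonneg fun _ _ => abs_nonneg _

/-- `deg(−g) ≤ k` if `deg g ≤ k`. [cite: Bazzi2009, §3 (p. 9)] -/
theorem hasDegreeLE_neg {k : ℕ} {g : (Fin n → Bool) → ℝ} (hg : HasDegreeLE k g) :
    HasDegreeLE k (fun x => -g x) := by
  rw [hasDegreeLE_iff_cubeFourierCoeff_eq_zero] at hg ⊢
  intro S hS
  rw [cubeFourierCoeff_neg, hg S hS, neg_zero]

/-- **`E_μ` in the Fourier domain**: `Σ_x μ(x) h(x) = Σ_S ĥ(S) · (Σ_x μ(x) χ_S(x))` (expand `h` in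
characters, p. 11: "write `p` as `p = Σ_y p̂(y) X_y`, thus `E_μ p = p̂(0) + Σ_{y≠0} p̂(y) E_μ X_y`").
[cite: Bazzi2009, §4 (p. 11)] -/
theorem sum_mul_eq_sum_cubeFourierCoeff_mul (μ h : (Fin n → Bool) → ℝ) :
    ∑ x, μ x * h x = ∑ S, cubeFourierCoeff h S * ∑ x, μ x * walsh S x := by
  calc ∑ x, μ x * h x = ∑ x, μ x * ∑ S, cubeFourierCoeff h S * walsh S x := by
        refine sum_congr rfl fun x _ => ?_
        rw [sum_cubeFourierCoeff_mul_walsh]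
    _ = ∑ x, ∑ S, cubeFourierCoeff h S * (μ x * walsh S x) := by
        refine sum_congr rfl fun x _ => ?_
        rw [mul_sum]
        exact sum_congr rfl fun S _ => by ring
    _ = ∑ S, cubeFourierCoeff h S * ∑ x, μ x * walsh S x := by
        rw [sum_comm]
        exact sum_congr rfl fun S _ => by rw [mul_sum]

/-- **(b) ⟹ `|E_μ h − E h| ≤ 2δ Σ_{S≠∅}|ĥ(S)|` for `deg h ≤ k` and `(δ,k)`-biased `μ`** (the estimate
behind both halves of Theorem A.1: `E_μ h = ĥ(∅) + Σ_{0<|S|≤k} ĥ(S) E_μ χ_S`, `|E_μ χ_S| ≤ 2δ`).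
[cite: Bazzi2009, §4 (p. 11) and App. A (p. 61)] -/
theorem abs_sum_mul_sub_cubeExpect_le {δ : ℝ} {k : ℕ} {μ h : (Fin n → Bool) → ℝ}
    (hμ : IsDeltaKBiased δ k μ) (hh : HasDegreeLE k h) :
    |∑ x, μ x * h x - cubeExpect h| ≤ 2 * δ * fourierTailL1 h := by
  obtain ⟨⟨_, hμ1⟩, hbias⟩ := hμ
  rw [hasDegreeLE_iff_cubeFourierCoeff_eq_zero] at hh
  rw [sum_mul_eq_sum_cubeFourierCoeff_mul, cubeExpect_eq_cubeFourierCoeff_empty,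
    ← (univ : Finset (Finset (Fin n))).add_sum_erase _ (mem_univ ∅)]
  have h0 : ∑ x, μ x * walsh (∅ : Finset (Fin n)) x = 1 := by simp [walsh_empty, hμ1]
  rw [h0, mul_one, add_sub_cancel_left, fourierTailL1, mul_sum]
  refine (abs_sum_le_sum_abs _ _).trans (sum_le_sum fun S hS => ?_)
  have hSne : S.Nonempty := nonempty_iff_ne_empty.2 (ne_of_mem_erase hS)
  rw [abs_mul]
  by_cases hSk : S.card ≤ k
  · have hb := hbias S hSne hSk
    calc |cubeFourierCoeff h S| * |∑ x, μ x * walsh S x|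
        ≤ |cubeFourierCoeff h S| * (2 * δ) := mul_le_mul_of_nonneg_left hb (abs_nonneg _)
      _ = 2 * δ * |cubeFourierCoeff h S| := by ring
  · rw [hh S (not_le.1 hSk), abs_zero, zero_mul, mul_zero]

/-- **(b) ⟹ (c)** (p. 10): a `k`-wise independent probability vector (character form: `E_μ χ_S = 0`
for `0 < |S| ≤ k`) satisfies `E_μ p = E p` for every `p` of degree `≤ k`.
[cite: Bazzi2009, §4, equivalence (b) ⟹ (c) (pp. 10–11)] -/
theorem sum_mul_eq_cubeExpect_of_hasDegreeLE {k : ℕ} {μ p : (Fin n → Bool) → ℝ}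
    (hμ : μ ∈ stdSimplex ℝ (Fin n → Bool))
    (hmom : ∀ S : Finset (Fin n), S.Nonempty → S.card ≤ k → ∑ x, μ x * walsh S x = 0)
    (hp : HasDegreeLE k p) : ∑ x, μ x * p x = cubeExpect p := by
  have hb : IsDeltaKBiased 0 k μ :=
    ⟨hμ, fun S hS hSk => by rw [hmom S hS hSk, abs_zero, mul_zero]⟩
  have := abs_sum_mul_sub_cubeExpect_le hb hp
  rw [mul_zero, zero_mul, abs_nonpos_iff, sub_eq_zero] at this
  exact this

/-! ### Weak duality: sandwiching polynomials fool (the "if" part, p. 11) -/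

/-- **The "if" part of Theorems 4.2/A.1** (p. 11, verbatim mechanism): if `g ≤ g_u`, `deg g_u ≤ k` and
`2δ Σ_{S≠∅}|ĝ_u(S)| + E(g_u − g) ≤ ε` then `E_μ g − E g ≤ ε` for every `(δ,k)`-biased `μ`
("`E_μ g − E g = E_μ(g − g_u) + E(g_u − g) ≤ E(g_u − g) ≤ ε`", corrected by the bias term).
[cite: Bazzi2009, §4 (p. 11) and Thm A.1 (pp. 60–61)] -/
theorem sum_mul_sub_cubeExpect_le_of_upper {δ ε : ℝ} {k : ℕ} {μ g gu : (Fin n → Bool) → ℝ}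
    (hμ : IsDeltaKBiased δ k μ) (hgu : HasDegreeLE k gu) (hle : ∀ x, g x ≤ gu x)
    (herr : 2 * δ * fourierTailL1 gu + cubeExpect (fun x => gu x - g x) ≤ ε) :
    ∑ x, μ x * g x - cubeExpect g ≤ ε := by
  have h1 : ∑ x, μ x * g x ≤ ∑ x, μ x * gu x :=
    sum_le_sum fun x _ => mul_le_mul_of_nonneg_left (hle x) (hμ.1.1 x)
  have h2 := (abs_le.1 (abs_sum_mul_sub_cubeExpect_le hμ hgu)).2
  rw [cubeExpect_sub] at herr
  linarith

/-- The mirror statement for a lower sandwiching polynomial: `E g − E_μ g ≤ ε`.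
[cite: Bazzi2009, §4 (p. 11) and Thm A.1 (pp. 60–61)] -/
theorem cubeExpect_sub_sum_mul_le_of_lower {δ ε : ℝ} {k : ℕ} {μ g gl : (Fin n → Bool) → ℝ}
    (hμ : IsDeltaKBiased δ k μ) (hgl : HasDegreeLE k gl) (hle : ∀ x, gl x ≤ g x)
    (herr : 2 * δ * fourierTailL1 gl + cubeExpect (fun x => g x - gl x) ≤ ε) :
    cubeExpect g - ∑ x, μ x * g x ≤ ε := by
  have h1 : ∑ x, μ x * gl x ≤ ∑ x, μ x * g x :=
    sum_le_sum fun x _ => mul_le_mul_of_nonneg_left (hle x) (hμ.1.1 x)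
  have h2 := (abs_le.1 (abs_sum_mul_sub_cubeExpect_le hμ hgl)).1
  rw [cubeExpect_sub] at herr
  linarith

/-- **Sandwiching polynomials fool** (the "if" part of Theorem A.1; Theorem 4.2's for `δ = 0`): a pair
`g_l ≤ g ≤ g_u` of degree `≤ k` with `2δ Σ_{S≠∅}|ĝ_l(S)| + E(g − g_l) ≤ ε` and
`2δ Σ_{S≠∅}|ĝ_u(S)| + E(g_u − g) ≤ ε` makes every `(δ,k)`-biased `μ` `ε`-fool `g`.
[cite: Bazzi2009, Thm A.1 "if" (pp. 60–61) and §4 (p. 11)] -/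
theorem fools_of_sandwich {δ ε : ℝ} {k : ℕ} {μ g gl gu : (Fin n → Bool) → ℝ}
    (hμ : IsDeltaKBiased δ k μ) (hgl : HasDegreeLE k gl) (hgu : HasDegreeLE k gu)
    (hl : ∀ x, gl x ≤ g x) (hu : ∀ x, g x ≤ gu x)
    (herrl : 2 * δ * fourierTailL1 gl + cubeExpect (fun x => g x - gl x) ≤ ε)
    (herru : 2 * δ * fourierTailL1 gu + cubeExpect (fun x => gu x - g x) ≤ ε) : Fools ε μ g := by
  rw [Fools, abs_sub_le_iff]
  exact ⟨sum_mul_sub_cubeExpect_le_of_upper hμ hgu hu herru,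
    cubeExpect_sub_sum_mul_le_of_lower hμ hgl hl herrl⟩

/-! ### The linear program of Appendix A (p. 61) and strong duality -/

/-- The constraint matrix of the primal LP `P_u` (p. 61) in the form `Aμ ≤ b`, `μ ≥ 0`: rows indexed
by `(S, b)`, `S ⊆ [n]`, `b` a sign (`sgn false = 1`, `sgn true = −1`); the row of `(S, b)` with
`|S| ≤ k` is `±χ_S` (for `S = ∅`: `±𝟙`, encoding `Σμ = 1`; for `0 < |S| ≤ k`: `±Σμχ_S ≤ 2δ`), rows with
`|S| > k` are zero. [cite: Bazzi2009, App. A, proof of Thm A.1 (p. 61)] -/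
def lpMatrix (n k : ℕ) : Matrix (Finset (Fin n) × Bool) (Fin n → Bool) ℝ :=
  fun p x => if p.1.card ≤ k then sgn p.2 * walsh p.1 x else 0

/-- The right-hand side of the primal LP (p. 61): `±1` on the two rows of `S = ∅`, `2δ` on the rows of
`0 < |S| ≤ k`, `0` on the (zero) rows `|S| > k`. [cite: Bazzi2009, App. A, proof of Thm A.1 (p. 61)] -/
def lpRhs (n k : ℕ) (δ : ℝ) : Finset (Fin n) × Bool → ℝ :=
  fun p => if p.1 = ∅ then sgn p.2 else if p.1.card ≤ k then 2 * δ else 0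

/-- The rows of `Aμ`. [cite: Bazzi2009, App. A (p. 61)] -/
theorem lpMatrix_mulVec (k : ℕ) (μ : (Fin n → Bool) → ℝ) (p : Finset (Fin n) × Bool) :
    (lpMatrix n k *ᵥ μ) p = if p.1.card ≤ k then sgn p.2 * ∑ x, μ x * walsh p.1 x else 0 := by
  simp only [mulVec, dotProduct, lpMatrix]
  split_ifs with h
  · rw [mul_sum]
    exact sum_congr rfl fun x _ => by ring
  · simp

/-- **Feasible points of the primal LP are exactly the `(δ,k)`-biased probability distributions**
(p. 61: "`M_k` consists of all `μ` such that `μ ≥ 0`, `Σ_x μ(x) = 1`, and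
`−2δ ≤ Σ_x μ(x)X_y(x) ≤ 2δ` for each `y ∈ N_k*`"), first half. [cite: Bazzi2009, App. A (p. 61)] -/
theorem isDeltaKBiased_of_feasible {δ : ℝ} {k : ℕ} {μ : (Fin n → Bool) → ℝ} (h0 : 0 ≤ μ)
    (hle : lpMatrix n k *ᵥ μ ≤ lpRhs n k δ) : IsDeltaKBiased δ k μ := by
  have row : ∀ p, (if p.1.card ≤ k then sgn p.2 * ∑ x, μ x * walsh p.1 x else 0) ≤ lpRhs n k δ p :=
    fun p => by rw [← lpMatrix_mulVec]; exact hle p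
  have hsum : ∑ x, μ x = 1 := by
    have h1 := row (∅, false)
    have h2 := row (∅, true)
    simp only [card_empty, zero_le, if_true, sgn_false, sgn_true, walsh_empty, mul_one, lpRhs] at h1 h2
    linarith
  refine ⟨⟨fun x => h0 x, hsum⟩, fun S hS hSk => ?_⟩
  have hSne : S ≠ ∅ := hS.ne_empty
  have h1 := row (S, false)
  have h2 := row (S, true)
  simp only [hSk, if_true, sgn_false, sgn_true, lpRhs, hSne, if_false, one_mul, neg_one_mul] at h1 h2
  rw [abs_le]
  exact ⟨by linarith, h1⟩

/-- Second half: a `(δ,k)`-biased probability distribution is feasible (`δ ≥ 0` makes the vacuous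
rows `|S| > k` consistent). [cite: Bazzi2009, App. A (p. 61)] -/
theorem feasible_of_isDeltaKBiased {δ : ℝ} {k : ℕ} {μ : (Fin n → Bool) → ℝ}
    (h : IsDeltaKBiased δ k μ) : 0 ≤ μ ∧ lpMatrix n k *ᵥ μ ≤ lpRhs n k δ := by
  obtain ⟨⟨h0, h1⟩, hbias⟩ := h
  refine ⟨fun x => h0 x, fun p => ?_⟩
  obtain ⟨S, b⟩ := p
  rw [lpMatrix_mulVec]
  simp only [lpRhs]
  by_cases hSk : S.card ≤ k
  · rw [if_pos hSk]
    by_cases hS : S = ∅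
    · subst hS
      simp [walsh_empty, h1]
    · rw [if_neg hS, if_pos hSk]
      have hb := hbias S (nonempty_iff_ne_empty.2 hS) hSk
      have hs : |sgn b| = 1 := by cases b <;> simp [sgn]
      calc sgn b * ∑ x, μ x * walsh S x ≤ |sgn b * ∑ x, μ x * walsh S x| := le_abs_self _
        _ = |∑ x, μ x * walsh S x| := by rw [abs_mul, hs, one_mul]
        _ ≤ 2 * δ := hb
  · rw [if_neg hSk]
    have hS : S ≠ ∅ := fun hS => hSk (by simp [hS])
    rw [if_neg hS, if_neg hSk]

/-- **The uniform distribution is `(δ,k)`-biased** for `δ ≥ 0` (`E χ_S = 0` for `S ≠ ∅`): the primal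
LP is feasible (p. 61: "We have two feasible linear programs"). [cite: Bazzi2009, App. A (p. 61)] -/
theorem isDeltaKBiased_uniform {δ : ℝ} (hδ : 0 ≤ δ) (k : ℕ) :
    IsDeltaKBiased δ k (fun _ : Fin n → Bool => ((2 : ℝ) ^ n)⁻¹) := by
  have h2 : (2 : ℝ) ^ n ≠ 0 := pow_ne_zero _ two_ne_zero
  refine ⟨⟨fun _ => by positivity, ?_⟩, fun S hS _ => ?_⟩
  · simp only [sum_const, card_univ, Fintype.card_fun, Fintype.card_bool, Fintype.card_fin,
      nsmul_eq_mul, Nat.cast_pow, Nat.cast_ofNat]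
    exact mul_inv_cancel₀ h2
  · rw [← mul_sum]
    have h := sum_walsh_mul_walsh_index S (∅ : Finset (Fin n))
    simp only [walsh_empty, mul_one, if_neg hS.ne_empty] at h
    rw [h, mul_zero, abs_zero]
    positivity

/-- **Reading a dual solution as a polynomial** (p. 61): for `y ≥ 0` indexed by the rows, the dual
slack function `yA` is the character combination `x ↦ Σ_{|S|≤k} (y(S,+) − y(S,−)) χ_S(x)` of degree
`≤ k`, and the dual objective is `yb = (y(∅,+) − y(∅,−)) + 2δ Σ_{0<|S|≤k} (y(S,+) + y(S,−))`.
[cite: Bazzi2009, App. A, proof of Thm A.1 (p. 61)] -/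
theorem vecMul_lpMatrix (k : ℕ) (y : Finset (Fin n) × Bool → ℝ) (x : Fin n → Bool) :
    (y ᵥ* lpMatrix n k) x =
      ∑ S ∈ univ.filter (fun S : Finset (Fin n) => S.card ≤ k),
        (y (S, false) - y (S, true)) * walsh S x := by
  simp only [vecMul, dotProduct, lpMatrix]
  rw [Fintype.sum_prod_type, sum_filter]
  refine sum_congr rfl fun S _ => ?_
  rw [Fintype.sum_bool]
  split_ifs with h
  · simp only [sgn_true, sgn_false]
    ring
  · simp

/-- The dual objective, read off. [cite: Bazzi2009, App. A, proof of Thm A.1 (p. 61)] -/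
theorem dotProduct_lpRhs (k : ℕ) (δ : ℝ) (y : Finset (Fin n) × Bool → ℝ) :
    y ⬝ᵥ lpRhs n k δ = (y (∅, false) - y (∅, true)) +
      2 * δ * ∑ S ∈ (univ.filter (fun S : Finset (Fin n) => S.card ≤ k)).erase ∅,
        (y (S, false) + y (S, true)) := by
  simp only [dotProduct, lpRhs]
  rw [Fintype.sum_prod_type, ← (univ : Finset (Finset (Fin n))).add_sum_erase _ (mem_univ ∅)]
  congr 1
  · rw [Fintype.sum_bool]
    simp only [if_true, sgn_true, sgn_false]
    ring
  · have hset : (univ.filter (fun S : Finset (Fin n) => S.card ≤ k)).erase ∅ =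
        (univ.erase ∅).filter (fun S : Finset (Fin n) => S.card ≤ k) := by
      ext S
      simp only [mem_erase, mem_filter, mem_univ, true_and]
      tauto
    rw [hset, sum_filter, mul_sum]
    refine sum_congr rfl fun S hS => ?_
    have hSne : S ≠ ∅ := ne_of_mem_erase hS
    rw [Fintype.sum_bool]
    simp only [hSne, if_false]
    split_ifs with h
    · ring
    · simp

/-- **Strong duality half of Theorem A.1** (p. 61, (I)): if every `(δ,k)`-biased probability
distribution `μ` has `E_μ g ≤ E g + ε` (`δ ≥ 0`), then there is `g_u ≥ g` of degree `≤ k` with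
`2δ Σ_{S≠∅}|ĝ_u(S)| + E(g_u − g) ≤ ε`.  Proof as printed: the primal LP
`max{E_μ g : μ ∈ M_k}` (feasible: the uniform distribution; bounded) equals its dual
`min{α_∅ + 2δ Σ(α'_S + α''_S) : α_∅ + Σ(α'_S − α''_S)χ_S ≥ g, α', α'' ≥ 0}` by the Duality theorem
of linear programming (`LPDuality.duality_nonneg_le`), and a dual optimum is read as `g_u`.
[cite: Bazzi2009, Thm A.1 "only if", App. A (p. 61)] -/
theorem exists_upper_sandwich {δ ε : ℝ} (hδ : 0 ≤ δ) {k : ℕ} {g : (Fin n → Bool) → ℝ}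
    (hfool : ∀ μ, IsDeltaKBiased δ k μ → ∑ x, μ x * g x ≤ cubeExpect g + ε) :
    ∃ gu : (Fin n → Bool) → ℝ, HasDegreeLE k gu ∧ (∀ x, g x ≤ gu x) ∧
      2 * δ * fourierTailL1 gu + cubeExpect (fun x => gu x - g x) ≤ ε := by
  set F : Finset (Finset (Fin n)) := univ.filter (fun S : Finset (Fin n) => S.card ≤ k) with hF
  -- primal feasibility: the uniform distribution
  have hP : ∃ μ : (Fin n → Bool) → ℝ, 0 ≤ μ ∧ lpMatrix n k *ᵥ μ ≤ lpRhs n k δ :=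
    ⟨_, feasible_of_isDeltaKBiased (isDeltaKBiased_uniform hδ k)⟩
  -- dual feasibility: the constant polynomial `M = Σ|g|`
  have hD : ∃ y : Finset (Fin n) × Bool → ℝ, 0 ≤ y ∧ g ≤ y ᵥ* lpMatrix n k := by
    refine ⟨fun p => if p = (∅, false) then ∑ x, |g x| else 0, fun p => ?_, fun x => ?_⟩
    · simp only [Pi.zero_apply]
      split_ifs
      · exact sum_nonneg fun x _ => abs_nonneg _
      · exact le_rfl
    · simp only [vecMul, dotProduct, lpMatrix, ite_mul, zero_mul, sum_ite_eq', mem_univ, if_true,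
        card_empty, zero_le, sgn_false, walsh_empty, mul_one]
      exact (le_abs_self (g x)).trans (single_le_sum (fun y _ => abs_nonneg (g y)) (mem_univ x))
  obtain ⟨μ, y, hμ0, hμA, hy0, hyA, hval⟩ :=
    Literature.Analysis.Convex.LPDuality.duality_nonneg_le (lpMatrix n k) (lpRhs n k δ) g hP hD
  -- the primal optimum is a biased distribution, hence fooled
  have hμb : IsDeltaKBiased δ k μ := isDeltaKBiased_of_feasible hμ0 hμA
  have hopt : y ⬝ᵥ lpRhs n k δ ≤ cubeExpect g + ε := by
    rw [← hval, dotProduct_comm]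
    exact hfool μ hμb
  -- read the dual optimum as a polynomial
  set a : Finset (Fin n) → ℝ := fun S => y (S, false) - y (S, true) with ha
  refine ⟨fun x => ∑ S ∈ F, a S * walsh S x, ?_, fun x => ?_, ?_⟩
  · rw [hasDegreeLE_iff_cubeFourierCoeff_eq_zero]
    intro S hS
    rw [cubeFourierCoeff_sum_walsh, if_neg]
    simp [hF, not_le.2 hS]
  · have h := hyA x
    rw [vecMul_lpMatrix] at h
    exact h
  · have hE : cubeExpect (fun x => ∑ S ∈ F, a S * walsh S x) = a ∅ := by
      rw [cubeExpect_eq_cubeFourierCoeff_empty, cubeFourierCoeff_sum_walsh, if_pos]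
      simp [hF]
    have htail : fourierTailL1 (fun x => ∑ S ∈ F, a S * walsh S x) ≤
        ∑ S ∈ F.erase ∅, (y (S, false) + y (S, true)) := by
      unfold fourierTailL1
      simp_rw [cubeFourierCoeff_sum_walsh]
      have hset : F.erase ∅ = (univ.erase ∅).filter (fun S => S ∈ F) := by
        ext S; simp [mem_erase, mem_filter]
      rw [hset, sum_filter]
      refine sum_le_sum fun S _ => ?_
      split_ifs
      · have h1 : 0 ≤ y (S, false) := hy0 _
        have h2 : 0 ≤ y (S, true) := hy0 _
        rw [ha, abs_sub_le_iff]
        constructor <;> linarith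
      · simp
    rw [cubeExpect_sub, hE]
    rw [dotProduct_lpRhs] at hopt
    have hmul : 2 * δ * fourierTailL1 (fun x => ∑ S ∈ F, a S * walsh S x) ≤
        2 * δ * ∑ S ∈ F.erase ∅, (y (S, false) + y (S, true)) :=
      mul_le_mul_of_nonneg_left htail (by positivity)
    have : a ∅ = y (∅, false) - y (∅, true) := rfl
    linarith

/-! ### Theorem A.1 and Theorem 4.2 -/

/-- **Bazzi 2009, Theorem A.1.** For `δ ≥ 0`, `k`, `ε` and `g : {0,1}ⁿ → ℝ`: the `(δ,k)`-bias property
`ε`-fools `g` (every `(δ,k)`-biased probability distribution `μ` has `|E_μ g − E g| ≤ ε`) if and only if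
there exist `g_l, g_u` with i) `deg g_l ≤ k`, `deg g_u ≤ k`; ii) `g_l ≤ g ≤ g_u`;
iii) `2δ Σ_{S≠∅}|ĝ_l(S)| + E(g − g_l) ≤ ε` and `2δ Σ_{S≠∅}|ĝ_u(S)| + E(g_u − g) ≤ ε` (print: Boolean `g`,
`ε ≥ 0`; proved for real `g` and all `ε`). [cite: Bazzi2009, Theorem A.1 (App. A, pp. 60–61)] -/
theorem Bazzi2009_thmA1 {δ : ℝ} (hδ : 0 ≤ δ) (k : ℕ) (ε : ℝ) (g : (Fin n → Bool) → ℝ) :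
    (∀ μ : (Fin n → Bool) → ℝ, IsDeltaKBiased δ k μ → Fools ε μ g) ↔
      ∃ gl gu : (Fin n → Bool) → ℝ,
        (HasDegreeLE k gl ∧ HasDegreeLE k gu) ∧ (∀ x, gl x ≤ g x ∧ g x ≤ gu x) ∧
        (2 * δ * fourierTailL1 gl + cubeExpect (fun x => g x - gl x) ≤ ε ∧
          2 * δ * fourierTailL1 gu + cubeExpect (fun x => gu x - g x) ≤ ε) := by
  constructor
  · intro h
    -- upper polynomial for `g`, and (the negative of) an upper polynomial for `−g`
    have hu : ∀ μ, IsDeltaKBiased δ k μ → ∑ x, μ x * g x ≤ cubeExpect g + ε := fun μ hμ => by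
      have := (abs_le.1 (h μ hμ)).2; linarith
    have hl : ∀ μ, IsDeltaKBiased δ k μ →
        ∑ x, μ x * (fun x => -g x) x ≤ cubeExpect (fun x => -g x) + ε := fun μ hμ => by
      have h1 := (abs_le.1 (h μ hμ)).1
      have h2 : cubeExpect (fun x => -g x) = -cubeExpect g := by
        unfold cubeExpect; rw [sum_neg_distrib, neg_div]
      have h3 : ∑ x, μ x * (fun x => -g x) x = -∑ x, μ x * g x := by
        rw [← sum_neg_distrib]; exact sum_congr rfl fun x _ => by ring
      rw [h2, h3]; linarith
    obtain ⟨gu, hgu, hgle, herru⟩ := exists_upper_sandwich hδ hu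
    obtain ⟨gl', hgl', hgle', herrl'⟩ := exists_upper_sandwich hδ hl
    refine ⟨fun x => -gl' x, gu, ⟨hasDegreeLE_neg hgl', hgu⟩,
      fun x => ⟨by have := hgle' x; linarith, hgle x⟩, ?_, herru⟩
    rw [fourierTailL1_neg]
    have : cubeExpect (fun x => g x - -gl' x) = cubeExpect (fun x => gl' x - -g x) :=
      congrArg cubeExpect (funext fun x => by ring)
    rw [this]
    exact herrl'
  · rintro ⟨gl, gu, ⟨hgl, hgu⟩, hsand, herrl, herru⟩ μ hμ
    exact fools_of_sandwich hμ hgl hgu (fun x => (hsand x).1) (fun x => (hsand x).2) herrl herru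

/-- **Bazzi 2009, Theorem 4.2** (`δ = 0`). For `k`, `ε` and `g : {0,1}ⁿ → ℝ`: the `k`-wise independence
property `ε`-fools `g` — every probability vector `μ` on `{0,1}ⁿ` with `E_μ χ_S = 0` for all
`0 < |S| ≤ k` (characterisation (b), p. 10) has `|E_μ g − E g| ≤ ε` — if and only if there exist
`g_l, g_u` with i) `deg g_l, deg g_u ≤ k`; ii) `g_l ≤ g ≤ g_u`; iii) `E(g − g_l) ≤ ε` and
`E(g_u − g) ≤ ε` (print: Boolean `g`, `ε ≥ 0`; proved for real `g` and all `ε`).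
[cite: Bazzi2009, Theorem 4.2 (§4, p. 10)] -/
theorem Bazzi2009_thm42 (k : ℕ) (ε : ℝ) (g : (Fin n → Bool) → ℝ) :
    (∀ μ : (Fin n → Bool) → ℝ, μ ∈ stdSimplex ℝ (Fin n → Bool) →
        (∀ S : Finset (Fin n), S.Nonempty → S.card ≤ k → ∑ x, μ x * walsh S x = 0) → Fools ε μ g) ↔
      ∃ gl gu : (Fin n → Bool) → ℝ,
        (HasDegreeLE k gl ∧ HasDegreeLE k gu) ∧ (∀ x, gl x ≤ g x ∧ g x ≤ gu x) ∧
        (cubeExpect (fun x => g x - gl x) ≤ ε ∧ cubeExpect (fun x => gu x - g x) ≤ ε) := by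
  have key : ∀ μ : (Fin n → Bool) → ℝ, IsDeltaKBiased 0 k μ ↔
      (μ ∈ stdSimplex ℝ (Fin n → Bool) ∧
        ∀ S : Finset (Fin n), S.Nonempty → S.card ≤ k → ∑ x, μ x * walsh S x = 0) := fun μ => by
    simp only [IsDeltaKBiased, mul_zero, abs_nonpos_iff]
  have hA := Bazzi2009_thmA1 le_rfl k ε g (n := n)
  simp only [mul_zero, zero_mul, zero_add] at hA
  rw [← hA]
  constructor
  · intro h μ hμ
    exact h μ ((key μ).1 hμ).1 ((key μ).1 hμ).2
  · intro h μ hμ hmom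
    exact h μ ((key μ).2 ⟨hμ, hmom⟩)

/-! ### The measure-theoretic vocabulary: `PMF`s and `IsDWiseIndependent` -/

section Bridge

variable {ι : Type} [Fintype ι] [DecidableEq ι]

omit [Fintype ι] in
/-- The indicator of a sub-cube face in characters: for `S ⊆ ι`, `x ∈ {0,1}^ι`, `z ∈ {0,1}^S`,
`𝟙[x|_S = z] = 2^{-|S|} Σ_{T ⊆ S} (∏_{i∈T} (−1)^{z_i}) χ_T(x)` (expand `∏_{i∈S} (1 + (−1)^{x_i}(−1)^{z_i})/2`).
[cite: Bazzi2009, §3 (p. 9, Fourier preliminaries) and §4 (p. 10, (a) ⟺ (b))] -/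
theorem indicator_restrict_eq (S : Finset ι) (x : ι → Bool) (z : S → Bool) :
    (if S.restrict x = z then (1 : ℝ) else 0) =
      ((2 : ℝ) ^ S.card)⁻¹ * ∑ T ∈ S.powerset,
        (∏ i ∈ T, if h : i ∈ S then sgn (z ⟨i, h⟩) else 0) * walsh T x := by
  set c : ι → ℝ := fun i => if h : i ∈ S then sgn (z ⟨i, h⟩) else 0 with hc
  have hprod : ∏ i ∈ S, (1 + sgn (x i) * c i) = if S.restrict x = z then (2 : ℝ) ^ S.card else 0 := by
    split_ifs with hz
    · rw [← prod_const]
      refine prod_congr rfl fun i hi => ?_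
      have : c i = sgn (x i) := by
        rw [hc]; simp only [hi, dif_pos]
        have := congrFun hz ⟨i, hi⟩
        simp only [Finset.restrict] at this
        rw [← this]
      rw [this, sgn_mul_self]; norm_num
    · obtain ⟨i, hi⟩ : ∃ i : S, x i ≠ z i := by
        by_contra hall
        push Not at hall
        exact hz (funext fun i => hall i)
      refine prod_eq_zero i.2 ?_
      have : c i = sgn (z i) := by rw [hc]; simp [i.2]
      rw [this, Literature.Probability.RandomGraphs.LowDegree.sgn_mul_sgn_of_ne hi]; norm_num
  have hexp : ∏ i ∈ S, (1 + sgn (x i) * c i) = ∑ T ∈ S.powerset, (∏ i ∈ T, c i) * walsh T x := by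
    rw [prod_one_add]
    refine sum_congr rfl fun T _ => ?_
    rw [walsh, ← prod_mul_distrib]
    exact prod_congr rfl fun i _ => by ring
  rw [← hexp, hprod]
  have h2 : (2 : ℝ) ^ S.card ≠ 0 := pow_ne_zero _ two_ne_zero
  split_ifs
  · rw [inv_mul_cancel₀ h2]
  · rw [mul_zero]

/-- The marginal on `S` in terms of character means: for `z ∈ {0,1}^S`,
`Pr_μ[x|_S = z] = 2^{-|S|} Σ_{T⊆S} (∏_{i∈T}(−1)^{z_i}) E_μ χ_T`. [cite: Bazzi2009, §4 (p. 10, (a) ⟺ (b))] -/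
theorem toReal_map_restrict_apply (μ : PMF (ι → Bool)) (S : Finset ι) (z : S → Bool) :
    (μ.map S.restrict z).toReal =
      ((2 : ℝ) ^ S.card)⁻¹ * ∑ T ∈ S.powerset,
        (∏ i ∈ T, if h : i ∈ S then sgn (z ⟨i, h⟩) else 0) * charMean μ T := by
  have h1 : (μ.map S.restrict z).toReal =
      ∑ x, (μ x).toReal * (if S.restrict x = z then (1 : ℝ) else 0) := by
    rw [sum_toReal_mul_comp μ S.restrict (fun z' => if z' = z then (1 : ℝ) else 0)]
    simp only [mul_ite, mul_one, mul_zero, Finset.sum_ite_eq', mem_univ, if_true]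
  rw [h1]
  simp_rw [indicator_restrict_eq S _ z, mul_sum, charMean]
  rw [sum_comm]
  refine sum_congr rfl fun T _ => ?_
  rw [mul_sum, mul_sum]
  exact sum_congr rfl fun x _ => by ring

/-- **(a) ⟺ (b) of p. 10: `k`-wise independence in characters.** A distribution `μ` on `{0,1}^ι` has
all its marginals on `≤ D` coordinates uniform (`IsDWiseIndependent D μ`, Bazzi's definition of
`D`-wise independence, p. 3) iff `E_μ χ_T = 0` for every `T` with `0 < |T| ≤ D`.  (⟹ is the tree's
`IsDWiseIndependent.charMean_eq_zero`; ⟸ is Fourier inversion on the face `{x|_S = z}`.)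
[cite: Bazzi2009, §4, "(a) ⟺ (b)" (p. 10)] -/
theorem isDWiseIndependent_iff_charMean_eq_zero {D : ℕ} {μ : PMF (ι → Bool)} :
    IsDWiseIndependent D μ ↔ ∀ T : Finset ι, T.Nonempty → T.card ≤ D → charMean μ T = 0 := by
  refine ⟨fun h T hT hTD => h.charMean_eq_zero hT hTD, fun h S hSD => ?_⟩
  ext z
  rw [PMF.uniformOfFintype_apply]
  have htop1 : μ.map S.restrict z ≠ ⊤ := PMF.apply_ne_top _ _
  have htop2 : ((Fintype.card (S → Bool) : ENNReal))⁻¹ ≠ ⊤ :=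
    ENNReal.inv_ne_top.2 (by exact_mod_cast Fintype.card_ne_zero)
  rw [← ENNReal.toReal_eq_toReal_iff' htop1 htop2, toReal_map_restrict_apply,
    ENNReal.toReal_inv, ENNReal.toReal_natCast, Fintype.card_fun, Fintype.card_bool,
    Fintype.card_coe, Nat.cast_pow, Nat.cast_ofNat]
  rw [sum_eq_single_of_mem ∅ (empty_mem_powerset S) fun T hT hTne => ?_]
  · simp [charMean_empty]
  · rw [h T (nonempty_iff_ne_empty.2 hTne) ((card_le_card (mem_powerset.1 hT)).trans hSD),
      mul_zero]

end Bridge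

/-- **Bazzi 2009, Theorem 4.2, over `PMF`s.** For `k`, `ε` and `g : {0,1}ⁿ → ℝ`: every `k`-wise
independent distribution `μ : PMF ({0,1}ⁿ)` (all marginals on `≤ k` coordinates uniform,
`IsDWiseIndependent k μ`) has `|E_μ g − E g| ≤ ε` if and only if `g` has sandwiching polynomials
`g_l ≤ g ≤ g_u` of degree `≤ k` with `E(g − g_l) ≤ ε` and `E(g_u − g) ≤ ε`.
[cite: Bazzi2009, Theorem 4.2 (§4, p. 10), with (a) ⟺ (b) (p. 10)] -/
theorem Bazzi2009_thm42_pmf (k : ℕ) (ε : ℝ) (g : (Fin n → Bool) → ℝ) :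
    (∀ μ : PMF (Fin n → Bool), IsDWiseIndependent k μ →
        |∑ x, (μ x).toReal * g x - cubeExpect g| ≤ ε) ↔
      ∃ gl gu : (Fin n → Bool) → ℝ,
        (HasDegreeLE k gl ∧ HasDegreeLE k gu) ∧ (∀ x, gl x ≤ g x ∧ g x ≤ gu x) ∧
        (cubeExpect (fun x => g x - gl x) ≤ ε ∧ cubeExpect (fun x => gu x - g x) ≤ ε) := by
  rw [← Bazzi2009_thm42]
  constructor
  · intro h μ hμ hmom
    obtain ⟨h0, h1⟩ := hμ
    -- the probability vector `μ` as a `PMF`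
    have hsum : ∑ x, ENNReal.ofReal (μ x) = 1 := by
      rw [← ENNReal.ofReal_sum_of_nonneg fun x _ => h0 x, h1, ENNReal.ofReal_one]
    set p : PMF (Fin n → Bool) := PMF.ofFintype (fun x => ENNReal.ofReal (μ x)) hsum with hp
    have hpx : ∀ x, (p x).toReal = μ x := fun x => by
      rw [hp, PMF.ofFintype_apply, ENNReal.toReal_ofReal (h0 x)]
    have hind : IsDWiseIndependent k p := by
      rw [isDWiseIndependent_iff_charMean_eq_zero]
      intro T hT hTk
      simp only [charMean, hpx]
      exact hmom T hT hTk
    have := h p hind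
    simp only [hpx] at this
    exact this
  · intro h μ hind
    have hmom := isDWiseIndependent_iff_charMean_eq_zero.1 hind
    exact h (fun x => (μ x).toReal) ⟨fun x => ENNReal.toReal_nonneg, sum_toReal_eq_one μ⟩
      fun S hS hSk => hmom S hS hSk

end Literature.Computability.Complexity.Sandwiching
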